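import Mathlib.Topology.Homotopy.Contractible
import Mathlib.Topology.PartitionOfUnity
import Mathlib.Topology.Metrizable.Urysohn
import Literature.Topology.FourManifolds.HomotopySpheresStablyParallelizable
import Literature.Topology.FourManifolds.HomotopySpheresInverse
import Literature.Topology.FourManifolds.HomotopySpheresSumDimOne
import Literature.Topology.FourManifolds.HomotopySpheresSumDimTwoLeaves
import Literature.Topology.FourManifolds.PuncturedHomotopySphereContractible
import Literature.Topology.FourManifolds.HCobordismLevelDeformationProof
import HarnessLib

/-!
# The stable tangent bundle of a homotopy sphere is trivial off a point — proofs

Trunk T-4MAN (`Literature/Topology/FourManifolds`). Companion of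
`HomotopySpheresStablyParallelizable.lean`, towards the named fact
`Literature.Topology.FourManifolds.HomotopySphere.hasStableTangentFramingAlong_compl_singleton`
(Kervaire–Milnor, *Groups of homotopy spheres I* (1963), proof of Thm. 3.1, p. 508, first
sentence: for a homotopy `n`-sphere `Σ` "the only obstruction to the triviality of `τ ⊕ ε¹` is a
well defined cohomology class `oₙ(Σ) ∈ Hⁿ(Σ; πₙ₋₁(SO_{n+1}))`", i.e. `τ ⊕ ε¹` is trivial over
`Σ` minus a point).

The standard justification — `Σ ∖ {x}` is contractible (Kervaire–Milnor p. 507, proof of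
Lemma 2.4) and bundles over contractible paracompact bases are trivial (the covering homotopy
theorem, Steenrod, *The Topology of Fibre Bundles*, §11) — is formalised here in the language of
frames, reducing the fact to the tree's named fact
`Literature.Topology.FourManifolds.HomotopySphere.contractibleSpace_compl_singleton`
(`HomotopySpheresInverse.lean`; punctured homotopy spheres are contractible, `n ≥ 2`):

* `Literature.Topology.FourManifolds.IsStableFrameFieldOn G F R`: `F` is a continuous, pointwise
  linearly independent family of `m + 1` sections of `G^*(TM ⊕ ℝ)` over the region `R`.
* `Literature.Topology.FourManifolds.HasStableTangentFramingAlong.homotopy` (**covering homotopy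
  theorem for stable framings**, proved): for a compact metrisable `K` and a homotopy
  `G : [0, 1] × K → M` into a `C¹` manifold modelled on `ℝᵐ`, a stable framing along `G(0, ·)`
  propagates to a stable framing along `G(1, ·)`. *Proof.* A Lebesgue number `δ` for the cover of
  `[0, 1] × K` by the preimages of chart domains; induction over time slabs of height `δ / 2`;
  inside a slab, a finite cover of `K` by `δ`-balls, a subordinate partition of unity `(τⱼ)`, and
  fronts `σ_J = a + (a' - a) Σ_{j ∈ J} τⱼ`; the frame is pushed across the patch
  `σ_J ≤ t ≤ σ_{J ∪ {j}}` (which lies over one chart domain) by keeping its chart coordinates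
  constant, and the pieces are pasted along closed sets.
* `Literature.Topology.FourManifolds.HasStableTangentFramingAlong.of_homotopic_const` (proved):
  `TM ⊕ ℝ` is framed along every null-homotopic map of a compact metrisable space.
* `Literature.Topology.FourManifolds.hasStableTangentFramingAlong_compl_singleton_of_contractibleSpace`
  (proved): on a compact metrisable `C¹` manifold `M` modelled on `ℝᵐ`, if `M ∖ {p}` is
  contractible then `TM ⊕ ℝ` is framed over `M ∖ {p}` — the framing along the (null-homotopic,
  compact) complement of an open chart ball about `p` is glued to the chart framing of the
  punctured ball, corrected along the boundary sphere by radial extension of the transition map.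
* `Literature.Topology.FourManifolds.HomotopySphere.hasStableTangentFramingAlong_compl_singleton_of_two`
  (proved): the named fact follows from the contractibility of punctured homotopy `2`-spheres
  ALONE — dimension `0` directly, dimension `1` from the tree theorem
  `HomotopySphere.contractibleSpace_compl_singleton_one`, dimensions `n ≥ 3` from the tree
  theorem `HomotopySphere.contractibleSpace_compl_singleton_of_hurewicz_of_le` and the PROVED
  Hurewicz theorem `Literature.AlgebraicTopology.SingularHomology.hurewicz_subsingleton_holds`;
  whence the fact from each of the existing named facts
  `HomotopySphere.contractibleSpace_compl_singleton` (Kervaire–Milnor p. 507),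
  `nonemptyDiffeomorphSphere_two` (`Θ₂ = 0`) and
  `exists_isMorse_ncard_criticalSetOfIndex_eq_one 2` (Matsumoto, Thm. 3.35)
  (`…_of_contractibleSpace_compl_singleton`, `…_of_nonemptyDiffeomorphSphere_two`,
  `…_of_niceMorse`).
* `Literature.Topology.FourManifolds.HomotopySphere.hasStableTangentFramingAlong_compl_singleton_holds`
  (**the discharge, no hypotheses**): `Θ₂ = 0` is now a theorem of the tree — Assertion 6 of
  Milnor's proof of the First Cancellation Theorem 5.4 (*Lectures on the h-cobordism theorem*,
  1965), assembled by `Cobordism.Milnor1965_cancellation_modelChart_of_parts` from the proved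
  aligned charts, the proved gluing, and the level isotopy of the PROVED deformation of the level
  diffeomorphism (`Cobordism.Milnor1965_cancellation_levelDeformation_holds`,
  `HCobordismLevelDeformationProof.lean`), fed to `nonemptyDiffeomorphSphere_two_of_modelChart`
  (`HomotopySpheresSumDimTwoLeaves.lean`) and then to `…_of_nonemptyDiffeomorphSphere_two`.

## References

* M. Kervaire, J. Milnor, *Groups of homotopy spheres I*, Ann. of Math. 77 (1963), §3, proof of
  Thm. 3.1, p. 508; §2, proof of Lemma 2.4, p. 507. [KervaireMilnorAnnals1963]
* N. Steenrod, *The Topology of Fibre Bundles* (1951), §11.3–11.6 (covering homotopy theorem,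
  bundles over contractible bases). [folklore]
* A. Hatcher, *Algebraic Topology* (2002), Prop. 4.48 (homotopy lifting for fibre bundles: the
  slab-and-front argument used here) and *Vector Bundles and K-Theory*, Thm. 1.6. [folklore]
* J. Milnor, *Lectures on the h-cobordism theorem*, Princeton (1965), Thm. 5.4 and its proof,
  Assertion 6 (PDF pp. 27–32). [MilnorHCobordism1965]
-/

open scoped Manifold ContDiff Topology unitInterval
open Set Function Bundle Metric Module

noncomputable section

namespace Literature.Topology.FourManifolds

/-- Local notation: `𝔼 n` is the model Euclidean space `EuclideanSpace ℝ (Fin n)`. -/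
local notation "𝔼 " n:arg => EuclideanSpace ℝ (Fin n)

/-! ### Stable frame fields along a map, over a region -/

section FrameField

variable {m : ℕ} {M : Type*} [TopologicalSpace M] [ChartedSpace (𝔼 m) M] [IsManifold (𝓡 m) 1 M]
  {X X' : Type*} [TopologicalSpace X] [TopologicalSpace X']

/-- **A stable frame field along `G` over the region `R`**: a family `F q = (F q 0, …, F q m)`
of `m + 1` vectors of `T_{G q} M × ℝ`, `q ∈ X`, whose tangent components are continuous into
`TM` on `R`, whose real components are continuous on `R`, and which is linearly independent at
every point of `R` — a continuous section over `R` of the stable frame bundle of `M` pulled back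
along `G` (Steenrod, *The Topology of Fibre Bundles*, §7–8; Kervaire–Milnor 1963, §3, framings of
`τ ⊕ ε¹`). For `R = univ` this is `HasStableTangentFramingAlong` up to reindexing
(`IsStableFrameFieldOn.hasStableTangentFramingAlong`). [folklore] -/
def IsStableFrameFieldOn (G : X → M) (F : X → Fin (m + 1) → (𝔼 m) × ℝ) (R : Set X) : Prop :=
  (∀ i, ContinuousOn
      (fun q => (TotalSpace.mk' (𝔼 m) (G q) (F q i).1 : TangentBundle (𝓡 m) M)) R) ∧
    (∀ i, ContinuousOn (fun q => (F q i).2) R) ∧ ∀ q ∈ R, LinearIndependent ℝ (F q)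

/-- **Transport of a frame in a chart trivialisation.** Given a chart `φ`, a map `G : X → M`, a
frame field `F` and a map `ρ : X → X` ("retraction onto the front"), the frame at `q` whose
chart-`φ` coordinates are those of the frame `F (ρ q)` at `G (ρ q)`:
`(dφ⁻¹_{φ(G q)} ∘ dφ_{G(ρ q)}) (F (ρ q))` on tangent components, unchanged real components. This is
parallel transport for the flat connection of the trivialisation `TM|_{φ.source} ≅ φ.source × ℝᵐ`
(Steenrod 1951, §11.3, the local step of the covering homotopy theorem). [folklore] -/
def frameChartTransport (φ : OpenPartialHomeomorph M (𝔼 m)) (G : X → M)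
    (F : X → Fin (m + 1) → (𝔼 m) × ℝ) (ρ : X → X) (q : X) (i : Fin (m + 1)) : (𝔼 m) × ℝ :=
  (mfderiv (𝓡 m) (𝓡 m) φ.symm (φ (G q)) (mfderiv (𝓡 m) (𝓡 m) φ (G (ρ q)) (F (ρ q) i).1),
    (F (ρ q) i).2)

namespace IsStableFrameFieldOn

variable {G : X → M} {F Φ : X → Fin (m + 1) → (𝔼 m) × ℝ} {R P : Set X}

/-- Restriction of a stable frame field to a smaller region. [folklore] -/
theorem mono (h : IsStableFrameFieldOn G F R) (hP : P ⊆ R) : IsStableFrameFieldOn G F P :=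
  ⟨fun i => (h.1 i).mono hP, fun i => (h.2.1 i).mono hP, fun q hq => h.2.2 q (hP hq)⟩

/-- Pull-back of a stable frame field along a map `ρ` continuous on `P` with `ρ(P) ⊆ R`.
[folklore] -/
theorem comp (h : IsStableFrameFieldOn G F R) {ρ : X' → X} {P : Set X'} (hρ : ContinuousOn ρ P)
    (hPR : MapsTo ρ P R) : IsStableFrameFieldOn (G ∘ ρ) (F ∘ ρ) P :=
  ⟨fun i => (h.1 i).comp hρ hPR, fun i => (h.2.1 i).comp hρ hPR, fun _ hq => h.2.2 _ (hPR hq)⟩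

/-- A family agreeing with a stable frame field on the region is a stable frame field there.
[folklore] -/
theorem congr (h : IsStableFrameFieldOn G F R) (hΦ : ∀ q ∈ R, Φ q = F q) :
    IsStableFrameFieldOn G Φ R :=
  ⟨fun i => (h.1 i).congr fun q hq => by simp only [hΦ q hq],
    fun i => (h.2.1 i).congr fun q hq => by simp only [hΦ q hq],
    fun q hq => (hΦ q hq) ▸ h.2.2 q hq⟩

/-- **Pasting stable frame fields along closed sets**: frame fields on closed regions `R`, `P`
which agree on `R ∩ P` paste (the one on `R` taking precedence) to a frame field on `R ∪ P`
(pasting lemma for continuous maps on a finite closed cover). [folklore] -/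
theorem union [DecidablePred (· ∈ R)] (hF : IsStableFrameFieldOn G F R)
    (hΦ : IsStableFrameFieldOn G Φ P) (hR : IsClosed R) (hPc : IsClosed P)
    (hagree : ∀ q ∈ R ∩ P, F q = Φ q) :
    IsStableFrameFieldOn G (R.piecewise F Φ) (R ∪ P) := by
  have hF' : ∀ q ∈ R, R.piecewise F Φ q = F q := fun q hq => by
    simp only [Set.piecewise, if_pos hq]
  have hΦ' : ∀ q ∈ P, R.piecewise F Φ q = Φ q := fun q hq => by
    by_cases h : q ∈ R
    · simp only [Set.piecewise, if_pos h]
      exact hagree q ⟨h, hq⟩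
    · simp only [Set.piecewise, if_neg h]
  refine ⟨fun i => ?_, fun i => ?_, fun q hq => ?_⟩
  · exact ((hF.1 i).congr fun q hq => by simp only [hF' q hq]).union_of_isClosed
      ((hΦ.1 i).congr fun q hq => by simp only [hΦ' q hq]) hR hPc
  · exact ((hF.2.1 i).congr fun q hq => by simp only [hF' q hq]).union_of_isClosed
      ((hΦ.2.1 i).congr fun q hq => by simp only [hΦ' q hq]) hR hPc
  · rcases hq with hq | hq
    · rw [hF' q hq]
      exact hF.2.2 q hq
    · rw [hΦ' q hq]
      exact hΦ.2.2 q hq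

/-- **The local step of the covering homotopy theorem** (Steenrod 1951, §11.3; Hatcher 2002,
proof of Prop. 4.48): if `F` is a stable frame field along `G` over `R`, `ρ` is continuous on
`C` and maps `C` into `R`, and `G` maps both `C` and `ρ(C)` into the domain of the chart at `z`,
then the chart transport of `F` is a stable frame field along `G` over `C` (push-forward of
continuous vector fields along the `C¹` maps `φ`, `φ⁻¹`, which have injective differentials).
[folklore] -/
theorem transport (h : IsStableFrameFieldOn G F R) (hG : Continuous G) (z : M) {ρ : X → X}
    {C : Set X} (hρ : ContinuousOn ρ C) (hρR : MapsTo ρ C R)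
    (hC : ∀ q ∈ C, G q ∈ (chartAt (𝔼 m) z).source)
    (hCρ : ∀ q ∈ C, G (ρ q) ∈ (chartAt (𝔼 m) z).source) :
    IsStableFrameFieldOn G (frameChartTransport (chartAt (𝔼 m) z) G F ρ) C := by
  set φ := chartAt (𝔼 m) z
  have hφd : φ.MDifferentiable (𝓡 m) (𝓡 m) := mdifferentiable_chart z
  have hφc : ContMDiffOn (𝓡 m) (𝓡 m) 1 φ φ.source := contMDiffOn_chart
  have hφc' : ContMDiffOn (𝓡 m) (𝓡 m) 1 φ.symm φ.target := contMDiffOn_chart_symm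
  -- the chart coordinates of the transported frame, continuous on `C`
  have ha : ∀ i, ContinuousOn
      (fun q => mfderiv (𝓡 m) (𝓡 m) φ (G (ρ q)) (F (ρ q) i).1) C := by
    intro i
    have h1 : ContinuousOn (fun q => (TotalSpace.mk' (𝔼 m) (G (ρ q)) (F (ρ q) i).1 :
        TangentBundle (𝓡 m) M)) C :=
      (h.1 i).comp hρ hρR
    have h2 := ContinuousOn.totalSpaceMk_mfderiv (g := G ∘ ρ) φ.open_source hφc h1
      (fun q hq => hCρ q hq)
    exact continuous_snd_tangentBundle_euclidean.comp_continuousOn h2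
  refine ⟨fun i => ?_, fun i => (h.2.1 i).comp hρ hρR, fun q hq => ?_⟩
  · have hin : ContinuousOn (fun q => (TotalSpace.mk' (𝔼 m) (φ (G q))
        (mfderiv (𝓡 m) (𝓡 m) φ (G (ρ q)) (F (ρ q) i).1) : TangentBundle (𝓡 m) (𝔼 m))) C :=
      ContinuousOn.totalSpaceMk_euclidean
        (φ.continuousOn.comp hG.continuousOn fun q hq => hC q hq) (ha i)
    have := ContinuousOn.totalSpaceMk_mfderiv (g := φ ∘ G) φ.open_target hφc' hin
      (fun q hq => φ.map_source (hC q hq))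
    refine this.congr fun q hq => ?_
    change (TotalSpace.mk' (𝔼 m) (G q) _ : TangentBundle (𝓡 m) M) =
      TotalSpace.mk' (𝔼 m) (φ.symm (φ (G q))) _
    rw [φ.left_inv (hC q hq)]
    rfl
  · -- linear independence: push `F (ρ q)` forward by the injective maps `dφ × id`, `dφ⁻¹ × id`
    let a : Fin (m + 1) → (𝔼 m) × ℝ := fun i =>
      (mfderiv (𝓡 m) (𝓡 m) φ (G (ρ q)) (F (ρ q) i).1, (F (ρ q) i).2)
    have hli1 : LinearIndependent ℝ a := by
      let D : (𝔼 m) →L[ℝ] (𝔼 m) := mfderiv (𝓡 m) (𝓡 m) φ (G (ρ q))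
      let L : ((𝔼 m) × ℝ) →ₗ[ℝ] ((𝔼 m) × ℝ) :=
        D.toLinearMap.prodMap (LinearMap.id : ℝ →ₗ[ℝ] ℝ)
      have hinj : Injective L := by
        simp only [L, LinearMap.coe_prodMap]
        exact (hφd.mfderiv_injective (hCρ q hq)).prodMap injective_id
      exact (h.2.2 _ (hρR hq)).map' L (LinearMap.ker_eq_bot.mpr hinj)
    let D' : (𝔼 m) →L[ℝ] (𝔼 m) := mfderiv (𝓡 m) (𝓡 m) φ.symm (φ (G q))
    let L' : ((𝔼 m) × ℝ) →ₗ[ℝ] ((𝔼 m) × ℝ) :=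
      D'.toLinearMap.prodMap (LinearMap.id : ℝ →ₗ[ℝ] ℝ)
    have hinj' : Injective L' := by
      simp only [L', LinearMap.coe_prodMap]
      exact (hφd.symm.mfderiv_injective (φ.map_source (hC q hq))).prodMap injective_id
    exact hli1.map' L' (LinearMap.ker_eq_bot.mpr hinj')

omit [TopologicalSpace X] in
/-- The chart transport does not move a frame sitting on the front: if `ρ q = q` and `G q` lies in
the chart domain then the transported frame at `q` is `F q` (`dφ⁻¹ ∘ dφ = id`). [folklore] -/
theorem _root_.Literature.Topology.FourManifolds.frameChartTransport_eq_self (z : M) {ρ : X → X}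
    {q : X} (hq : ρ q = q) (hGq : G q ∈ (chartAt (𝔼 m) z).source) :
    frameChartTransport (chartAt (𝔼 m) z) G F ρ q = F q := by
  funext i
  have key : mfderiv (𝓡 m) (𝓡 m) (chartAt (𝔼 m) z).symm (chartAt (𝔼 m) z (G q))
      (mfderiv (𝓡 m) (𝓡 m) (chartAt (𝔼 m) z) (G q) (F q i).1) = (F q i).1 :=
    DFunLike.congr_fun ((mdifferentiable_chart z).symm_comp_deriv hGq) (F q i).1
  refine Prod.ext ?_ ?_
  · change mfderiv (𝓡 m) (𝓡 m) (chartAt (𝔼 m) z).symm (chartAt (𝔼 m) z (G q))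
      (mfderiv (𝓡 m) (𝓡 m) (chartAt (𝔼 m) z) (G (ρ q)) (F (ρ q) i).1) = (F q i).1
    rw [hq]
    exact key
  · change (F (ρ q) i).2 = (F q i).2
    rw [hq]

/-- A stable framing along `f` (tree predicate `HasStableTangentFramingAlong`, sections indexed by
`Fin (finrank ℝ ℝᵐ + 1)`) gives a stable frame field along `f` over `univ` (reindexing by
`Fin (m + 1)`). [folklore] -/
theorem _root_.Literature.Topology.FourManifolds.HasStableTangentFramingAlong.exists_isStableFrameFieldOn
    {f : X → M} (h : HasStableTangentFramingAlong (𝓡 m) M f) :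
    ∃ F : X → Fin (m + 1) → (𝔼 m) × ℝ, IsStableFrameFieldOn f F univ := by
  have hN : finrank ℝ (𝔼 m) + 1 = m + 1 := by simp
  obtain ⟨s, hs1, hs2, hsli⟩ := h
  refine ⟨fun q i => s (Fin.cast hN.symm i) q, fun i => (hs1 _).continuousOn,
    fun i => (hs2 _).continuousOn, fun q _ => ?_⟩
  exact (hsli q).comp (Fin.cast hN.symm) (Fin.cast_injective _)

/-- Conversely, a stable frame field along `f` over `univ` is a stable framing along `f`.
[folklore] -/
theorem hasStableTangentFramingAlong {f : X → M} (h : IsStableFrameFieldOn f F univ) :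
    HasStableTangentFramingAlong (𝓡 m) M f := by
  have hN : finrank ℝ (𝔼 m) + 1 = m + 1 := by simp
  refine ⟨fun i q => F q (Fin.cast hN i), fun i => ?_, fun i => ?_, fun q => ?_⟩
  · exact continuousOn_univ.mp (h.1 _)
  · exact continuousOn_univ.mp (h.2.1 _)
  · exact (h.2.2 q (mem_univ q)).comp (Fin.cast hN) (Fin.cast_injective _)

end IsStableFrameFieldOn

end FrameField

/-! ### The covering homotopy theorem for stable framings -/

section CoveringHomotopy

variable {m : ℕ} {M : Type*} [TopologicalSpace M] [ChartedSpace (𝔼 m) M] [IsManifold (𝓡 m) 1 M]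
  {K : Type*} [TopologicalSpace K] [CompactSpace K] [TopologicalSpace.MetrizableSpace K]

/-- **Covering homotopy theorem for stable framings** (Steenrod, *The Topology of Fibre Bundles*
(1951), §11.3, first covering homotopy theorem, for the stable frame bundle and a compact
metrisable parameter space; Hatcher, *Algebraic Topology*, Prop. 4.48). Let `M` be a `C¹` manifold
modelled on `ℝᵐ`, `K` a compact metrisable space and `G : [0, 1] × K → M` a homotopy. If
`TM ⊕ ℝ` is framed along `G(0, ·)` then it is framed along `G(1, ·)`.

*Proof.* Let `δ` be a Lebesgue number of the cover of `[0, 1] × K` by the preimages of the chart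
domains of `M`, `ε = δ / 2`, `aₖ = min(kε, 1)`. By induction on `k` there is a stable frame field
along `G` over the slab `{t ≤ aₖ}`: for `k = 0` it is the given framing; for the step, cover `K`
by finitely many `δ`-balls `B(yⱼ, δ)`, so that `G` maps `[aₖ, aₖ₊₁] × B(yⱼ, δ)` into one chart
domain `Vⱼ`, choose a partition of unity `(τⱼ)` subordinate to the balls and, by induction on
finite sets `J` of indices, extend the frame field over `{t ≤ σ_J(y)}`,
`σ_J = aₖ + (aₖ₊₁ - aₖ) Σ_{j ∈ J} τⱼ`: the patch `σ_J(y) ≤ t ≤ σ_{J ∪ {j}}(y)` lies over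
`tsupport τⱼ ⊆ B(yⱼ, δ)`, hence is mapped into `Vⱼ`, and there the frame is defined by keeping
the chart-`Vⱼ` coordinates of the frame on the front `t = σ_J(y)` constant
(`IsStableFrameFieldOn.chartTransport`); old and new pieces agree on the front and paste along
closed sets (`IsStableFrameFieldOn.union`). At `k` with `kε ≥ 1` the slab is everything. This is the
bundle-theoretic input of Kervaire–Milnor 1963, proof of Thm. 3.1, p. 508 (triviality of `τ ⊕ ε¹`
below the top obstruction). [folklore] -/
theorem HasStableTangentFramingAlong.homotopy (G : C(I × K, M))
    (h0 : HasStableTangentFramingAlong (𝓡 m) M (fun y => G (0, y))) :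
    HasStableTangentFramingAlong (𝓡 m) M (fun y => G (1, y)) := by
  classical
  letI : MetricSpace K := TopologicalSpace.metrizableSpaceMetric K
  -- a Lebesgue number for the cover of `I × K` by the preimages of the chart domains
  obtain ⟨δ, hδ, hcov⟩ : ∃ δ > 0, ∀ q : I × K, ∃ z : M,
      ball q δ ⊆ G ⁻¹' (chartAt (𝔼 m) z).source := by
    obtain ⟨δ, hδ, h⟩ := lebesgue_number_lemma_of_metric (ι := M)
      (c := fun z => G ⁻¹' (chartAt (𝔼 m) z).source) isCompact_univ
      (fun z => (chartAt (𝔼 m) z).open_source.preimage G.continuous)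
      (fun q _ => mem_iUnion.mpr ⟨G q, mem_chart_source _ _⟩)
    exact ⟨δ, hδ, fun q => h q (mem_univ q)⟩
  -- time levels `a k = min (k ε) 1`, `ε = δ / 2`, and the slabs `R k = {t ≤ a k}`
  set ε : ℝ := δ / 2 with hε
  have hε0 : 0 < ε := half_pos hδ
  have hεδ : ε < δ := half_lt_self hδ
  let a : ℕ → ℝ := fun k => min (k * ε) 1
  have ha0 : ∀ k, 0 ≤ a k := fun k => le_min (by positivity) zero_le_one
  have ha1 : ∀ k, a k ≤ 1 := fun k => min_le_right _ _
  have hmono : ∀ k, a k ≤ a (k + 1) := fun k =>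
    min_le_min_right _ (by push_cast; nlinarith [hε0])
  have hstep : ∀ k, a (k + 1) ≤ a k + ε := by
    intro k
    change min (((k + 1 : ℕ) : ℝ) * ε) 1 ≤ min ((k : ℝ) * ε) 1 + ε
    rcases le_total ((k : ℝ) * ε) 1 with h | h
    · rw [min_eq_left h]
      refine (min_le_left _ _).trans ?_
      push_cast
      linarith
    · rw [min_eq_right h]
      exact (min_le_right _ _).trans (le_add_of_nonneg_right hε0.le)
  let R : ℕ → Set (I × K) := fun k => {q | (q.1 : ℝ) ≤ a k}
  -- the main induction over slabs
  have main : ∀ k, ∃ F : I × K → Fin (m + 1) → (𝔼 m) × ℝ,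
      IsStableFrameFieldOn G F (R k) := by
    intro k
    induction k with
    | zero =>
      obtain ⟨F₀, hF₀⟩ := h0.exists_isStableFrameFieldOn
      refine ⟨fun q => F₀ q.2, fun i => ?_, fun i => ?_, fun q _ => hF₀.2.2 q.2 (mem_univ _)⟩
      · have hc : Continuous fun q : I × K =>
            (TotalSpace.mk' (𝔼 m) (G (0, q.2)) (F₀ q.2 i).1 : TangentBundle (𝓡 m) M) :=
          (continuousOn_univ.mp (hF₀.1 i)).comp continuous_snd
        have ha00 : a 0 = 0 := by
          change min (((0 : ℕ) : ℝ) * ε) 1 = 0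
          rw [Nat.cast_zero, zero_mul, min_eq_left (zero_le_one' ℝ)]
        refine hc.continuousOn.congr fun q hq => ?_
        obtain ⟨t, y⟩ := q
        have ht : (t : ℝ) ≤ a 0 := hq
        rw [ha00] at ht
        have ht0 : t = 0 := Subtype.ext (le_antisymm ht t.2.1)
        subst ht0
        rfl
      · exact ((continuousOn_univ.mp (hF₀.2.1 i)).comp continuous_snd).continuousOn
    | succ k ih =>
      obtain ⟨F, hF⟩ := ih
      have hA0 : 0 ≤ a k := ha0 k
      have hAA' : a k ≤ a (k + 1) := hmono k
      have hA'A : a (k + 1) ≤ a k + ε := hstep k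
      have hA'1 : a (k + 1) ≤ 1 := ha1 (k + 1)
      let tA : I := ⟨a k, hA0, ha1 k⟩
      -- a finite cover of `K` by `δ`-balls and a chart domain over each `[a k, a (k+1)] × ball`
      obtain ⟨t, ht⟩ : ∃ t : Finset K, (univ : Set K) ⊆ ⋃ y ∈ t, ball y δ :=
        isCompact_univ.elim_finite_subcover (fun y : K => ball y δ) (fun _ => isOpen_ball)
          fun y _ => mem_iUnion.mpr ⟨y, mem_ball_self hδ⟩
      choose z hz using fun y : K => hcov (tA, y)
      have hsrc : ∀ (c : K) (q : I × K), q.2 ∈ ball c δ → a k ≤ q.1 → (q.1 : ℝ) ≤ a (k + 1) →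
          G q ∈ (chartAt (𝔼 m) (z c)).source := by
        intro c q hy h1 h2
        have hq : q ∈ ball (tA, c) δ := by
          rw [← ball_prod_same]
          refine ⟨?_, hy⟩
          rw [mem_ball, Subtype.dist_eq, Real.dist_eq]
          change |(q.1 : ℝ) - a k| < δ
          rw [abs_of_nonneg (sub_nonneg.mpr h1)]
          linarith
        exact hz c hq
      -- a partition of unity on `K` subordinate to the balls, indexed by the centres
      obtain ⟨τ, hτ⟩ : ∃ τ : PartitionOfUnity (↥t) K univ,
          τ.IsSubordinate fun c => ball (c : K) δ := by
        refine PartitionOfUnity.exists_isSubordinate isClosed_univ _ (fun _ => isOpen_ball) ?_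
        intro y _
        have := ht (mem_univ y)
        simp only [mem_iUnion] at this
        obtain ⟨c, hc, hyc⟩ := this
        exact mem_iUnion.mpr ⟨⟨c, hc⟩, hyc⟩
      -- the fronts `fr J = a k + (a (k+1) - a k) Σ_{j ∈ J} τ j`
      let fr : Finset (↥t) → K → ℝ := fun J y => a k + (a (k + 1) - a k) * ∑ j ∈ J, τ j y
      have hfrc : ∀ J, Continuous (fr J) := fun J => by
        change Continuous fun y => a k + (a (k + 1) - a k) * ∑ j ∈ J, τ j y
        exact continuous_const.add (continuous_const.mul
          (continuous_finsetSum J fun j _ => (τ j).continuous))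
      have hfrA : ∀ J y, a k ≤ fr J y := fun J y =>
        le_add_of_nonneg_right (mul_nonneg (sub_nonneg.mpr hAA')
          (Finset.sum_nonneg fun j _ => τ.nonneg j y))
      have hfrA' : ∀ J y, fr J y ≤ a (k + 1) := fun J y => by
        have h1 : ∑ j ∈ J, τ j y ≤ 1 :=
          (Finset.sum_le_univ_sum_of_nonneg fun j => τ.nonneg j y).trans
            (by rw [← finsum_eq_sum_of_fintype]; exact τ.sum_le_one y)
        have h2 : (a (k + 1) - a k) * ∑ j ∈ J, τ j y ≤ (a (k + 1) - a k) * 1 :=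
          mul_le_mul_of_nonneg_left h1 (sub_nonneg.mpr hAA')
        change a k + (a (k + 1) - a k) * ∑ j ∈ J, τ j y ≤ a (k + 1)
        linarith
      -- induction over finite sets of indices
      have inner : ∀ J : Finset (↥t), ∃ F' : I × K → Fin (m + 1) → (𝔼 m) × ℝ,
          IsStableFrameFieldOn G F' {q : I × K | (q.1 : ℝ) ≤ fr J q.2} := by
        intro J
        induction J using Finset.induction_on with
        | empty =>
          refine ⟨F, ?_⟩
          have : {q : I × K | (q.1 : ℝ) ≤ fr ∅ q.2} = R k := by
            ext q
            simp [fr, R]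
          rw [this]
          exact hF
        | insert j J hj ihJ =>
          obtain ⟨F₁, hF₁⟩ := ihJ
          have hfrins : ∀ y, fr (insert j J) y = fr J y + (a (k + 1) - a k) * τ j y := fun y => by
            simp only [fr, Finset.sum_insert hj]
            ring
          have hfrle : ∀ y, fr J y ≤ fr (insert j J) y := fun y => by
            rw [hfrins]
            exact le_add_of_nonneg_right (mul_nonneg (sub_nonneg.mpr hAA') (τ.nonneg j y))
          -- the old region, the retraction onto its front, and the patch
          set Rfr : Set (I × K) := {q | (q.1 : ℝ) ≤ fr J q.2} with hRfr
          have hRc : IsClosed Rfr :=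
            isClosed_le (continuous_subtype_val.comp continuous_fst) ((hfrc J).comp continuous_snd)
          let ρ : I × K → I × K := fun q =>
            (⟨fr J q.2, hA0.trans (hfrA J q.2), (hfrA' J q.2).trans hA'1⟩, q.2)
          have hρ : Continuous ρ :=
            (((hfrc J).comp continuous_snd).subtype_mk _).prodMk continuous_snd
          have hρR : MapsTo ρ univ Rfr := fun q _ => le_refl (fr J q.2)
          let P : Set (I × K) :=
            {q | fr J q.2 ≤ q.1 ∧ (q.1 : ℝ) ≤ fr (insert j J) q.2 ∧ q.2 ∈ tsupport (τ j)}
          have hPc : IsClosed P := by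
            refine (isClosed_le ((hfrc J).comp continuous_snd)
              (continuous_subtype_val.comp continuous_fst)).inter
              ((isClosed_le (continuous_subtype_val.comp continuous_fst)
                ((hfrc _).comp continuous_snd)).inter ?_)
            exact (isClosed_tsupport _).preimage continuous_snd
          have hPsrc : ∀ q ∈ P, G q ∈ (chartAt (𝔼 m) (z j)).source := fun q hq =>
            hsrc j q (hτ j hq.2.2) ((hfrA J q.2).trans hq.1) (hq.2.1.trans (hfrA' _ q.2))
          have hPρsrc : ∀ q ∈ P, G (ρ q) ∈ (chartAt (𝔼 m) (z j)).source := fun q hq =>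
            hsrc j (ρ q) (hτ j hq.2.2) (hfrA J q.2) (hfrA' J q.2)
          -- the transported frame on the patch, pasted to the old one
          have hT : IsStableFrameFieldOn G (frameChartTransport (chartAt (𝔼 m) (z j)) G F₁ ρ) P :=
            hF₁.transport G.continuous (z j) hρ.continuousOn (fun q _ => hρR (mem_univ q))
              hPsrc hPρsrc
          have hagree : ∀ q ∈ Rfr ∩ P,
              F₁ q = frameChartTransport (chartAt (𝔼 m) (z j)) G F₁ ρ q := by
            rintro q ⟨hq1, hq2⟩
            have heq : ρ q = q := by
              obtain ⟨s, y⟩ := q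
              have h1 : (s : ℝ) ≤ fr J y := hq1
              have h2 : fr J y ≤ (s : ℝ) := hq2.1
              exact Prod.ext (Subtype.ext (le_antisymm h2 h1)) rfl
            exact (frameChartTransport_eq_self (z j) heq (hPsrc q hq2)).symm
          have hU := hF₁.union hT hRc hPc hagree
          refine ⟨Rfr.piecewise F₁ (frameChartTransport (chartAt (𝔼 m) (z j)) G F₁ ρ), ?_⟩
          have hset : {q : I × K | (q.1 : ℝ) ≤ fr (insert j J) q.2} = Rfr ∪ P := by
            ext q
            simp only [hRfr, mem_setOf_eq, mem_union, P]
            constructor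
            · intro hq
              by_cases h : (q.1 : ℝ) ≤ fr J q.2
              · exact Or.inl h
              · refine Or.inr ⟨(not_le.mp h).le, hq, ?_⟩
                apply subset_tsupport
                rw [mem_support]
                intro h0
                rw [hfrins, h0, mul_zero, add_zero] at hq
                exact h hq
            · rintro (hq | ⟨-, hq, -⟩)
              · exact hq.trans (hfrle q.2)
              · exact hq
          rw [hset]
          exact hU
      -- `J = univ`: the front is `t = a (k + 1)`
      obtain ⟨F', hF'⟩ := inner Finset.univ
      refine ⟨F', ?_⟩
      have hset : R (k + 1) = {q : I × K | (q.1 : ℝ) ≤ fr Finset.univ q.2} := by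
        ext q
        have h1 : ∑ j, τ j q.2 = 1 := by
          rw [← finsum_eq_sum_of_fintype]
          exact τ.sum_eq_one (mem_univ q.2)
        simp only [R, fr, mem_setOf_eq, h1, mul_one]
        constructor <;> intro h <;> linarith
      rw [hset]
      exact hF'
  -- a slab index `k₀` with `k₀ ε ≥ 1`: the slab is everything
  obtain ⟨k₀, hk₀⟩ : ∃ k₀ : ℕ, 1 ≤ (k₀ : ℝ) * ε := by
    obtain ⟨k₀, hk₀⟩ := exists_nat_ge (1 / ε)
    exact ⟨k₀, by rwa [div_le_iff₀ hε0] at hk₀⟩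
  have hR : R k₀ = univ := by
    refine eq_univ_of_forall fun q => ?_
    change (q.1 : ℝ) ≤ min ((k₀ : ℝ) * ε) 1
    rw [min_eq_right hk₀]
    exact q.1.2.2
  obtain ⟨F, hF⟩ := main k₀
  rw [hR] at hF
  exact (hF.comp (ρ := fun y : K => ((1 : I), y)) (P := univ) (by fun_prop)
    (mapsTo_univ _ _)).hasStableTangentFramingAlong

/-- **`TM ⊕ ℝ` is framed along every null-homotopic map of a compact metrisable space** into a
`C¹` manifold modelled on `ℝᵐ`: a constant map is framed by a fixed stable frame (the chart frame
at the point, `hasTangentFramingAlong_of_mem_maximalAtlas`), and the framing propagates along the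
null-homotopy (`HasStableTangentFramingAlong.homotopy`). Equivalently: the pull-back of the
stable tangent bundle along a null-homotopic map is trivial (Steenrod 1951, §11.5–11.6).
[folklore] -/
theorem HasStableTangentFramingAlong.of_homotopic_const {f : C(K, M)} {x₀ : M}
    (h : f.Homotopic (ContinuousMap.const K x₀)) :
    HasStableTangentFramingAlong (𝓡 m) M f := by
  obtain ⟨H⟩ := h.symm
  -- the constant map is framed
  have h0 : HasStableTangentFramingAlong (𝓡 m) M (fun _ : K => x₀) := by
    have he : chartAt (𝔼 m) x₀ ∈ IsManifold.maximalAtlas (𝓡 m) 1 M :=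
      IsManifold.chart_mem_maximalAtlas x₀
    have hfr := (hasTangentFramingAlong_of_mem_maximalAtlas he).stable continuous_subtype_val
    exact hfr.comp ⟨fun _ : K => (⟨x₀, mem_chart_source _ x₀⟩ : (chartAt (𝔼 m) x₀).source),
      continuous_const⟩
  have h0' : HasStableTangentFramingAlong (𝓡 m) M (fun y => H.toContinuousMap (0, y)) := by
    convert h0 using 1
    funext y
    exact H.apply_zero y
  have h1 := HasStableTangentFramingAlong.homotopy H.toContinuousMap h0'
  convert h1 using 1
  funext y
  exact (H.apply_one y).symm

end CoveringHomotopy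

/-! ### Framing the stable tangent bundle off a point with contractible complement -/

section Puncture

variable {m : ℕ} {M : Type*} [TopologicalSpace M] [ChartedSpace (𝔼 m) M] [IsManifold (𝓡 m) 1 M]

/-- **If `M ∖ {p}` is contractible then `TM ⊕ ℝ` is trivial over `M ∖ {p}`** (`M` a compact
metrisable `C¹` manifold modelled on `ℝᵐ`; "bundles over contractible bases are trivial",
Steenrod 1951, §11.6, in the form needed by Kervaire–Milnor 1963, proof of Thm. 3.1, p. 508).
*Proof.* Let `φ` be the chart at `p`, `B̄(φ p, r) ⊆ φ.target`, `O = φ⁻¹(B(φ p, r)) ∋ p` the open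
chart ball and `D = φ⁻¹(B̄(φ p, r))`. The complement `Oᶜ` is compact and contained in the
contractible `M ∖ {p}`, so its inclusion into `M` is null-homotopic and `TM ⊕ ℝ` is framed along
it (`HasStableTangentFramingAlong.of_homotopic_const`), say by `s`. On the punctured closed ball
`D ∖ {p}` take the chart transport `A` of `s` along the radial projection `pr` onto the sphere
`φ⁻¹(S(φ p, r)) ⊆ Oᶜ` (`IsStableFrameFieldOn.transport`: the chart coordinates of `A(y)` are
those of `s(pr y)`); `A = s` on `Oᶜ ∩ D`, where `pr = id`. Pulled back to the subtype `M ∖ {p}`,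
the two pieces live on the closed sets `Oᶜ` and `D ∖ {p}`, which cover, and paste
(`IsStableFrameFieldOn.union`). [folklore] -/
theorem hasStableTangentFramingAlong_compl_singleton_of_contractibleSpace [T2Space M]
    [CompactSpace M] [TopologicalSpace.MetrizableSpace M] (p : M)
    (hc : ContractibleSpace ↥(({p} : Set M)ᶜ)) :
    HasStableTangentFramingAlong (𝓡 m) M ((↑) : ((({p} : Set M)ᶜ : Set M)) → M) := by
  classical
  let φ := chartAt (𝔼 m) p
  let b : 𝔼 m := φ p
  have hps : p ∈ φ.source := mem_chart_source _ p
  obtain ⟨r, hr, hball⟩ : ∃ r > (0 : ℝ), closedBall b r ⊆ φ.target := by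
    obtain ⟨r, hr, h⟩ := Metric.isOpen_iff.mp φ.open_target b (mem_chart_target _ p)
    exact ⟨r / 2, half_pos hr, (closedBall_subset_ball (half_lt_self hr)).trans h⟩
  -- the open chart ball `O ∋ p` and the closed chart ball `D ⊇ O`
  let O : Set M := φ.source ∩ φ ⁻¹' ball b r
  have hO : IsOpen O := φ.isOpen_inter_preimage isOpen_ball
  have hpO : p ∈ O := ⟨hps, mem_ball_self hr⟩
  have hKU : Oᶜ ⊆ (({p} : Set M)ᶜ : Set M) :=
    compl_subset_compl.mpr (singleton_subset_iff.mpr hpO)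
  let D : Set M := φ.symm '' closedBall b r
  have hD : IsClosed D :=
    ((isCompact_closedBall b r).image_of_continuousOn (φ.continuousOn_symm.mono hball)).isClosed
  have hOD : O ⊆ D := fun y hy => ⟨φ y, ball_subset_closedBall hy.2, φ.left_inv hy.1⟩
  have hDs : D ⊆ φ.source := by
    rintro _ ⟨x, hx, rfl⟩
    exact φ.map_target (hball hx)
  -- Step 1: `TM ⊕ ℝ` is framed along the inclusion of the compact set `Oᶜ ⊆ M ∖ {p}`, which is
  -- null-homotopic in `M` because `M ∖ {p}` is contractible
  have hK : HasStableTangentFramingAlong (𝓡 m) M ((↑) : (Oᶜ : Set M) → M) := by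
    haveI : CompactSpace (Oᶜ : Set M) :=
      isCompact_iff_compactSpace.mp hO.isClosed_compl.isCompact
    haveI := hc
    let jK : C((Oᶜ : Set M), (({p} : Set M)ᶜ : Set M)) :=
      ⟨Set.inclusion hKU, continuous_inclusion hKU⟩
    let v : C((({p} : Set M)ᶜ : Set M), M) := ⟨Subtype.val, continuous_subtype_val⟩
    obtain ⟨u₀, hu⟩ := id_nullhomotopic (({p} : Set M)ᶜ : Set M)
    have h1 := (ContinuousMap.Homotopic.refl v).comp (hu.comp (ContinuousMap.Homotopic.refl jK))
    have h2 : v.comp ((ContinuousMap.const _ u₀).comp jK) =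
        ContinuousMap.const (Oᶜ : Set M) (u₀ : M) := by
      ext y
      rfl
    rw [h2] at h1
    exact HasStableTangentFramingAlong.of_homotopic_const h1
  -- the framing as a total function `s'` on `M`: a stable frame field over `Oᶜ`
  obtain ⟨F₀, hF₀⟩ := hK.exists_isStableFrameFieldOn
  let s' : M → Fin (m + 1) → (𝔼 m) × ℝ := fun y => if h : y ∈ O then 0 else F₀ ⟨y, h⟩
  have hs'eq : ∀ y : (Oᶜ : Set M), s' y = F₀ y := fun y => by
    simp only [s', dif_neg (show ¬ ((y : M) ∈ O) from y.2)]
  have hS' : IsStableFrameFieldOn (id : M → M) s' Oᶜ := by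
    refine ⟨fun i => ?_, fun i => ?_, fun y hy => ?_⟩
    · rw [continuousOn_iff_continuous_restrict]
      convert continuousOn_univ.mp (hF₀.1 i) using 1
      funext y
      change (TotalSpace.mk' (𝔼 m) (y : M) (s' y i).1 : TangentBundle (𝓡 m) M) =
        TotalSpace.mk' (𝔼 m) (y : M) (F₀ y i).1
      rw [hs'eq]
    · rw [continuousOn_iff_continuous_restrict]
      convert continuousOn_univ.mp (hF₀.2.1 i) using 1
      funext y
      change (s' y i).2 = (F₀ y i).2
      rw [hs'eq]
    · rw [show s' y = F₀ ⟨y, hy⟩ from hs'eq ⟨y, hy⟩]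
      exact hF₀.2.2 _ (mem_univ _)
  -- Step 2: the radial projection `pr` of the punctured closed chart ball `D ∖ {p}` onto the
  -- sphere `φ⁻¹(S(b, r)) ⊆ Oᶜ`, and the chart transport `A` of `s'` along it
  have hne : ∀ y ∈ D \ {p}, φ y - b ≠ 0 := by
    rintro y ⟨hyD, hyp⟩ h
    exact hyp (φ.injOn (hDs hyD) hps (sub_eq_zero.mp h))
  let pr : M → M := fun y => φ.symm (b + (r * ‖φ y - b‖⁻¹) • (φ y - b))
  have hpr_sphere : ∀ y ∈ D \ {p}, b + (r * ‖φ y - b‖⁻¹) • (φ y - b) ∈ sphere b r := by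
    intro y hy
    rw [mem_sphere, dist_eq_norm, add_sub_cancel_left, norm_smul, Real.norm_eq_abs,
      abs_of_pos (mul_pos hr (inv_pos.mpr (norm_pos_iff.mpr (hne y hy)))),
      inv_mul_cancel_right₀ (norm_ne_zero_iff.mpr (hne y hy))]
  have hprt : ∀ y ∈ D \ {p}, b + (r * ‖φ y - b‖⁻¹) • (φ y - b) ∈ φ.target := fun y hy =>
    hball (sphere_subset_closedBall (hpr_sphere y hy))
  have hprC : ContinuousOn pr (D \ {p}) := by
    have hφ : ContinuousOn φ (D \ {p}) := φ.continuousOn.mono fun y hy => hDs hy.1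
    have hsub : ContinuousOn (fun y => φ y - b) (D \ {p}) := hφ.sub continuousOn_const
    have hinv : ContinuousOn (fun y => ‖φ y - b‖⁻¹) (D \ {p}) :=
      hsub.norm.inv₀ fun y hy => norm_ne_zero_iff.mpr (hne y hy)
    have hcoef : ContinuousOn (fun y => r * ‖φ y - b‖⁻¹) (D \ {p}) :=
      continuousOn_const.mul hinv
    have hsm : ContinuousOn (fun y => (r * ‖φ y - b‖⁻¹) • (φ y - b)) (D \ {p}) :=
      hcoef.smul hsub
    have h1 : ContinuousOn (fun y => b + (r * ‖φ y - b‖⁻¹) • (φ y - b)) (D \ {p}) :=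
      continuousOn_const.add hsm
    exact φ.continuousOn_symm.comp h1 fun y hy => hprt y hy
  have hprs : ∀ y ∈ D \ {p}, pr y ∈ φ.source := fun y hy => φ.map_target (hprt y hy)
  have hprO : MapsTo pr (D \ {p}) Oᶜ := by
    intro y hy hO'
    have h1 : φ (pr y) = b + (r * ‖φ y - b‖⁻¹) • (φ y - b) := φ.right_inv (hprt y hy)
    have h2 : φ (pr y) ∈ ball b r := hO'.2
    rw [h1] at h2
    exact (ne_of_lt (mem_ball.mp h2)) (mem_sphere.mp (hpr_sphere y hy))
  have hA : IsStableFrameFieldOn (id : M → M) (frameChartTransport φ id s' pr) (D \ {p}) :=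
    hS'.transport continuous_id p hprC hprO (fun y hy => hDs hy.1) (fun y hy => hprs y hy)
  -- on `Oᶜ ∩ D` (the preimage of the sphere) `pr = id`, so that `A = s'` there
  have hprfix : ∀ y ∈ Oᶜ ∩ D, pr y = y := by
    rintro y ⟨hyO, x, hx, rfl⟩
    have hxt : x ∈ φ.target := hball hx
    have hxr : ‖x - b‖ = r := by
      refine le_antisymm (mem_closedBall_iff_norm.mp hx)
        (not_lt.mp fun hlt => hyO ⟨φ.map_target hxt, ?_⟩)
      change φ (φ.symm x) ∈ ball b r
      rw [φ.right_inv hxt]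
      exact mem_ball_iff_norm.mpr hlt
    change φ.symm (b + (r * ‖φ (φ.symm x) - b‖⁻¹) • (φ (φ.symm x) - b)) = φ.symm x
    rw [φ.right_inv hxt, hxr, mul_inv_cancel₀ hr.ne', one_smul, add_sub_cancel]
  -- Step 3: pull both pieces back to the subtype `M ∖ {p}`, where they live on closed sets
  -- covering everything, and paste
  have hR : IsStableFrameFieldOn (id ∘ ((↑) : (({p} : Set M)ᶜ : Set M) → M)) (s' ∘ (↑))
      ((↑) ⁻¹' Oᶜ) :=
    hS'.comp continuous_subtype_val.continuousOn fun x hx => hx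
  have hP : IsStableFrameFieldOn (id ∘ ((↑) : (({p} : Set M)ᶜ : Set M) → M))
      (frameChartTransport φ id s' pr ∘ (↑)) ((↑) ⁻¹' D) :=
    hA.comp continuous_subtype_val.continuousOn fun x hx => ⟨hx, x.2⟩
  have hRc : IsClosed (((↑) : (({p} : Set M)ᶜ : Set M) → M) ⁻¹' Oᶜ) :=
    hO.isClosed_compl.preimage continuous_subtype_val
  have hPc : IsClosed (((↑) : (({p} : Set M)ᶜ : Set M) → M) ⁻¹' D) :=
    hD.preimage continuous_subtype_val
  have hagree : ∀ x ∈ ((↑) : (({p} : Set M)ᶜ : Set M) → M) ⁻¹' Oᶜ ∩ (↑) ⁻¹' D,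
      (s' ∘ (↑)) x = (frameChartTransport φ id s' pr ∘ (↑)) x := by
    rintro x ⟨hxO, hxD⟩
    exact (frameChartTransport_eq_self p (hprfix x ⟨hxO, hxD⟩) (hDs hxD)).symm
  have hU := hR.union hP hRc hPc hagree
  have huniv : ((↑) : (({p} : Set M)ᶜ : Set M) → M) ⁻¹' Oᶜ ∪ (↑) ⁻¹' D = univ := by
    refine eq_univ_of_forall fun x => ?_
    by_cases hx : (x : M) ∈ O
    · exact Or.inr (hOD hx)
    · exact Or.inl hx
  rw [huniv] at hU
  exact hU.hasStableTangentFramingAlong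

end Puncture

/-! ### Homotopy spheres -/

namespace HomotopySphere

/-- **The stable tangent bundle of a homotopy sphere is trivial off a point, GIVEN only the
contractibility of punctured homotopy `2`-spheres.** Kervaire–Milnor 1963, proof of Thm. 3.1,
p. 508, first sentence (`oₙ(Σ)` is the only obstruction to the triviality of `τ ⊕ ε¹`), in every
dimension, from the single hypothesis that `Σ ∖ {x}` is contractible for homotopy `2`-spheres
`Σ`: dimension `0` is the stabilised empty framing (`finrank ℝ ℝ⁰ = 0`); dimension `1` uses the
tree theorem `HomotopySphere.contractibleSpace_compl_singleton_one`; dimensions `n ≥ 3` use the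
tree theorem `HomotopySphere.contractibleSpace_compl_singleton_of_hurewicz_of_le` with the
Hurewicz theorem PROVED in the tree
(`Literature.AlgebraicTopology.SingularHomology.hurewicz_subsingleton_holds`); all cases then go
through `hasStableTangentFramingAlong_compl_singleton_of_contractibleSpace` (covering homotopy
theorem for stable framings and gluing over the punctured chart ball).
[cite: KervaireMilnorAnnals1963, §3, proof of Thm. 3.1, p. 508 (first sentence); §2, proof of Lemma 2.4, p. 507] -/
theorem hasStableTangentFramingAlong_compl_singleton_of_two
    (h2 : ∀ (S : HomotopySphere 2) (x : S.carrier), ContractibleSpace ↥(({x} : Set S.carrier)ᶜ)) :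
    hasStableTangentFramingAlong_compl_singleton := by
  intro n S x
  rcases Nat.lt_or_ge n 3 with hn | hn
  · interval_cases n
    · -- dimension `0`: the empty tangent framing, stabilised
      have h0 : finrank ℝ (𝔼 0) = 0 := by simp
      haveI : IsEmpty (Fin (finrank ℝ (𝔼 0))) := ⟨fun i => Fin.elim0 (i.cast h0)⟩
      have hT : HasTangentFramingAlong (𝓡 0) S.carrier
          ((↑) : ((({x} : Set S.carrier)ᶜ : Set S.carrier)) → S.carrier) :=
        ⟨fun i => isEmptyElim i, fun i => isEmptyElim i, fun _ => linearIndependent_empty_type⟩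
      exact hT.stable continuous_subtype_val
    · -- dimension `1`: punctured homotopy `1`-spheres are contractible (tree theorem)
      exact hasStableTangentFramingAlong_compl_singleton_of_contractibleSpace x
        (S.contractibleSpace_compl_singleton_one x)
    · exact hasStableTangentFramingAlong_compl_singleton_of_contractibleSpace x (h2 S x)
  · -- dimensions `n ≥ 3`: Whitehead–Hurewicz, proved in the tree
    exact hasStableTangentFramingAlong_compl_singleton_of_contractibleSpace x
      (contractibleSpace_compl_singleton_of_hurewicz_of_le
        Literature.AlgebraicTopology.SingularHomology.hurewicz_subsingleton_holds hn S x)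

/-- **The stable tangent bundle of a homotopy sphere is trivial off a point, GIVEN the
contractibility of punctured homotopy spheres** (the named fact
`HomotopySphere.contractibleSpace_compl_singleton` of `HomotopySpheresInverse.lean`, the homotopy
theory in Kervaire–Milnor's proof of Lemma 2.4, p. 507, of which only the case `n = 2` is used).
[cite: KervaireMilnorAnnals1963, §3, proof of Thm. 3.1, p. 508 (first sentence); §2, proof of Lemma 2.4, p. 507] -/
theorem hasStableTangentFramingAlong_compl_singleton_of_contractibleSpace_compl_singleton
    (h : HomotopySphere.contractibleSpace_compl_singleton) :
    hasStableTangentFramingAlong_compl_singleton :=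
  hasStableTangentFramingAlong_compl_singleton_of_two fun S x => h 2 S x le_rfl

/-- **The fact from `Θ₂ = 0` alone**: given the smooth Poincaré conjecture in dimension `2`
(`nonemptyDiffeomorphSphere_two`, classification of surfaces; Kervaire–Milnor p. 507), punctured
homotopy `2`-spheres are contractible by the stereographic projection
(`HomotopySphere.contractibleSpace_compl_singleton_of_nonemptyDiffeomorphSphere`), whence
`hasStableTangentFramingAlong_compl_singleton`.
[cite: KervaireMilnorAnnals1963, §3, proof of Thm. 3.1, p. 508; §2 p. 507 (Θ₂ = 0)] -/
theorem hasStableTangentFramingAlong_compl_singleton_of_nonemptyDiffeomorphSphere_two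
    (h2 : nonemptyDiffeomorphSphere_two.{0}) : hasStableTangentFramingAlong_compl_singleton :=
  hasStableTangentFramingAlong_compl_singleton_of_two fun S x =>
    contractibleSpace_compl_singleton_of_nonemptyDiffeomorphSphere (fun M _ _ _ => h2 M) S x

/-- **The fact from Matsumoto's Thm. 3.35 in dimension `2` alone** (a closed connected surface
carries a Morse function with one minimum and one maximum,
`exists_isMorse_ncard_criticalSetOfIndex_eq_one 2`): punctured homotopy `2`-spheres are then
contractible by the Morse–Reeb route of `HomotopySpheresSumDimTwoLeaves.lean`
(`HomotopySphere.contractibleSpace_compl_singleton_two_of_niceMorse`).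
[cite: KervaireMilnorAnnals1963, §3, proof of Thm. 3.1, p. 508] [cite: Matsumoto2001, Thm. 3.35] -/
theorem hasStableTangentFramingAlong_compl_singleton_of_niceMorse
    (hU : exists_isMorse_ncard_criticalSetOfIndex_eq_one.{0} 2) :
    hasStableTangentFramingAlong_compl_singleton :=
  hasStableTangentFramingAlong_compl_singleton_of_two fun S x =>
    contractibleSpace_compl_singleton_two_of_niceMorse hU S x

/-- **Discharge of `Literature.Topology.FourManifolds.HomotopySphere.hasStableTangentFramingAlong_compl_singleton`,
no hypotheses** — Kervaire–Milnor 1963, proof of Thm. 3.1, p. 508, first sentence: for a homotopy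
`n`-sphere `Σ` *"the only obstruction to the triviality of `τ ⊕ ε¹` is a well defined cohomology
class `oₙ(Σ)`"*, i.e. `τ(Σ) ⊕ ε¹` is trivial over `Σ` minus a point, in every dimension `n`.
By `hasStableTangentFramingAlong_compl_singleton_of_nonemptyDiffeomorphSphere_two` (dimensions
`0`, `1`, `≥ 3` proved there outright; covering homotopy theorem for stable framings over the
contractible `Σ ∖ {x}`), its input `Θ₂ = 0` (`nonemptyDiffeomorphSphere_two`, Kervaire–Milnor
p. 507) being a theorem of the tree: `nonemptyDiffeomorphSphere_two_of_modelChart`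
(`HomotopySpheresSumDimTwoLeaves.lean`: no saddles on a simply connected closed surface, Reeb's
sphere theorem, Milnor's rearrangement and cancellation on a slab) applied to Assertion 6 of
Milnor's proof of Thm. 5.4, which `Cobordism.Milnor1965_cancellation_modelChart_of_parts`
assembles from the proved aligned charts (`Cobordism.Milnor1965_cancellation_alignedCharts_holds`),
the proved gluing (`Cobordism.Milnor1965_cancellation_glueCharts_holds`) and the level isotopy
(`Cobordism.Milnor1965_cancellation_levelIsotopy_of_deformation`, Lemma 4.7) of the PROVED
deformation of the level diffeomorphism (`Cobordism.Milnor1965_cancellation_levelDeformation_holds`,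
Thm. 5.6).
[cite: KervaireMilnorAnnals1963, §3, proof of Thm. 3.1, p. 508 (first sentence); §2 p. 507 (proof of Lemma 2.4; Θ₂ = 0)] [cite: MilnorHCobordism1965, proof of Thm. 5.4, Assertion 6 (PDF pp. 30–32); Lemma 4.7; Thm. 5.6] -/
theorem hasStableTangentFramingAlong_compl_singleton_holds :
    hasStableTangentFramingAlong_compl_singleton :=
  hasStableTangentFramingAlong_compl_singleton_of_nonemptyDiffeomorphSphere_two
    (nonemptyDiffeomorphSphere_two_of_modelChart
      (Cobordism.Milnor1965_cancellation_modelChart_of_parts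
        Cobordism.Milnor1965_cancellation_alignedCharts_holds
        (Cobordism.Milnor1965_cancellation_levelIsotopy_of_deformation
          Cobordism.Milnor1965_cancellation_levelDeformation_holds)
        Cobordism.Milnor1965_cancellation_glueCharts_holds))

end HomotopySphere

end Literature.Topology.FourManifolds
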